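import Summits.QuantumFields.BalabanUV.T4Continuum.Support.NE7ExpansionStructure
import Summits.QuantumFields.BalabanUV.T4Continuum.Support.NE7ExpansionSegmentLetters
import Summits.QuantumFields.BalabanUV.T4Continuum.Support.NE7DcurlBaseLipschitz
import Summits.QuantumFields.BalabanUV.T4Continuum.Support.NE3EnergySmallFieldCurl
import HarnessLib

/-!
# NE7ExpansionRemainderCurvedWeak — THE EXPANSION LETTER (hEXP) OF THE CURVED (APE) SKELETON F55 AT AN ARBITRARY UNITARY BACKGROUND `W`, WEAK FORM:
# `|dAction (We^{A}) Y − dAction W Y − hess W A Y| ≤ ρ_W(α₀, d)·‖Y‖_{ℓ¹}`, `ρ_W = 2·#Plane·(288δ + 48(1 + 6δ)α₀)·α₀`, `δ = e^{α₀} − 1` — `O(α₀²)`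

Cell `pub-balaban`, rung (B)+1 sub-cell t4, lineage `b2b-balaban-t4-ne7-p1` (CRUX PROVER NE7 #1 = OWNER of row NE7), generation 75.  File F56 — the first DISCHARGED
letter of the curved (APE) programme opened by F55 `NE7CurvedLiftBookkeeping` (this generation), over F45 `NE7ExpansionStructure.abs_dAction_vary_sub_hess_le` (the
mean-value reduction at ANY background), F47 `NE7DcurlBaseLipschitz.norm_dcurlAt_sub_dcurlAt_le`, row NE3's `NE3CurlStability.norm_curlAt_vary_sub_le`,
`NE3EnergySmallFieldCurl.norm_hol_vary_sub_hol_le_curl`, `NE3HessContinuity.norm_dcurlAt_le`, `NE3HessBounds.norm_curlAt_le`, and F48a's window sum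
`NE7ExpansionSegmentLetters.sum_perWin_bondL1At_le`.

WHY.  F55's letter (hEXP) is the genuine second-order remainder of the first variation at a background that need not be critical:
`|dAction (vary W A 1) Y (perWin d P) − dAction W Y (perWin d P) − hess W A Y (perWin d P)| ≤ ρ·dirL1 Y (periodBox P)` for every skew `P`-periodic `Y`.
By F45 it is bounded by `sup_{s ∈ [0,1]} |hess (We^{sA}) A Y − hess W A Y|`, i.e. by the LIPSCHITZ CONSTANT OF THE MIXED HESSIAN IN ITS BASE along the
segment `s ↦ We^{sA}`, whose links stay within `δ = e^{α₀} − 1` of `W`'s.  Plaquette by plaquette, `hessPlaqAt V X Y = −Re tr[(dcurlAt V X Y + (d_VY)(d_VX))·V(∂p′)]`,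
and each factor is Lipschitz in `V` (F47: `dcurlAt`, `60δ`; row NE3: `d_V`, `6δ`; the plaquette variable, `‖(We^{sA})(∂p′) − W(∂p′)‖ ≤ (1 + 6δ)·bl₁(A)(p′)`):
THIS IS BACKGROUND-GENERIC — no flatness, no smallness of `W` — so F45's WEAK remainder holds VERBATIM at a curved `W`.

WHAT ([folklore] lattice calculus; 0 def, 0 sorry):
§1 **`abs_hessPlaqAt_vary_sub_le_W`** — per plaquette, for unitary `W`, skew `A` with `‖A(b)‖ ≤ α₀`, `s ∈ [0,1]`, ANY `Y`:
   `|hessPlaqAt (We^{sA}) A Y p′ − hessPlaqAt W A Y p′| ≤ (288δ + 48(1 + 6δ)α₀)·α₀·bl₁(Y)(p′)` (`δ = e^{α₀} − 1`; `bl₁(A)(p′) ≤ 4α₀`).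
§2 **`abs_hess_vary_sub_hess_le_W`** — the window sum over one period: `≤ 2·#Plane·(288δ + 48(1+6δ)α₀)·α₀·dirL1 Y (periodBox P)` for `P`-periodic `Y`.
§3 **`abs_dAction_vary_sub_dAction_sub_hess_le_W`** — F55's (hEXP) AT ANY UNITARY BACKGROUND with `ρ_W = 2·#Plane·(288δ + 48(1 + 6δ)α₀)·α₀`;
   **`rhoW_le_of_le_one`** — for `α₀ ≤ 1`: `δ ≤ 2α₀` and `ρ_W ≤ 2·#Plane·1200·α₀²`.
CURRENCY (honest): in F55's regime `α₀ = α̂∕M` this is `O(M⁻²)` — the WEAK letter, one power of `M` short of what the slice solver (`K_G ∼ M`) tolerates for a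
closing bootstrap (cf. F48b's docstring at the flat datum: the STRONG `O(M⁻³)` form needs the cubic vertex moved onto `Y` by summation by parts and the
adjacent differences `α₀α₁` of `𝒬(A)`; its curved twin — COVARIANT summation by parts at `W`, with curvature junk `O(x·α₀²)` — is the successor's file).  So
this file DISCHARGES F55's (hEXP) as a true statement with an explicit `ρ`, but does not by itself put `ρ` in the closing currency.
HONEST FRAMING (page 1): elementary lattice calculus on OUR objects at an arbitrary unitary background; nothing of Bałaban's asserted; (APE) on curved data
NOT proved; NOT ONE-STEP, NOT NE7; spine 0∕9; finite T⁴ rung (B)+1 — NOT infinite volume, NOT mass gap, NOT `BetaPertH`, NOT Clay.  Continuum YM on T⁴ ⇐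
BetaPertH ∧ nine spine estimates (0/9 proved); BetaPertH ⇐ (D1) ∧ (D4) ∧ CAP+tail; G-an2-4 gates asym, D1 and NE2/3/4.
-/

set_option autoImplicit false

open scoped BigOperators Matrix.Norms.L2Operator
open NormedSpace Finset Set

namespace Summit.QuantumFields.BalabanUV.T4Continuum.NE7ExpansionRemainderCurvedWeak

open Literature.MathematicalPhysics.QuantumFieldTheory.Balaban1983to89
open B7Prop1Explicit B7Prop2Explicit MatrixLog UnitaryModel MatrixNorms
open T4AveragingDeficitWall (IsUnitaryCfg IsSkewDir SmallField vary curlAt dirL1 vary_zero)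
open T4AveragingDeficitWallBoundary (periodBox)
open AveragingDeficitPeriodicCounting (IsPeriodicDir)
open AveragingDeficitTransport (mem_U1_of_unitary)
open AveragingDeficitPlaqDeriv (vary_isUnitaryCfg)
open MinimalActionLevels (perWin)
open NE3HessForm (hess hessPlaq hessPlaqAt dcurlAt dAction)
open NE3HessBounds (norm_curlAt_le)
open NE3HessContinuity (bondL1At bondL1At_nonneg norm_dcurlAt_le)
open NE3CurlStability (norm_curlAt_vary_sub_le norm_vary_sub_le_of_sup)
open NE3EnergySmallFieldCurl (norm_hol_vary_sub_hol_le_curl)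
open NE7DcurlBaseLipschitz (norm_dcurlAt_sub_dcurlAt_le)
open NE7ExpansionStructure (abs_dAction_vary_sub_hess_le)
open NE7ExpansionSegmentLetters (sum_perWin_bondL1At_le)

noncomputable section

variable {d : ℕ} {n : Type*} [Fintype n] [DecidableEq n]

/-! ## §1 One plaquette: the mixed Hessian density is Lipschitz in its base along the segment `We^{sA}` -/

/-- `‖(d_V X)(p′)‖ ≤ bl₁(X)(p′)` for unitary `V` (row NE3's `norm_curlAt_le` in the `bondL1At` spelling). [folklore] -/
theorem norm_curlAt_le_bondL1At {V : Site d → Fin d → (Matrix n n ℂ)ˣ} (hV : IsUnitaryCfg V) (X : Site d → Fin d → Matrix n n ℂ) (z : Site d) (μ ν : Fin d) :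
    ‖curlAt V X z μ ν‖ ≤ bondL1At X z μ ν := by
  unfold bondL1At; exact norm_curlAt_le hV X z μ ν

/-- `bl₁(A)(p′) ≤ 4α₀` when `‖A(b)‖ ≤ α₀`. [folklore] -/
theorem bondL1At_le_four_mul {A : Site d → Fin d → Matrix n n ℂ} {α₀ : ℝ} (hAα : ∀ y κ, ‖A y κ‖ ≤ α₀) (z : Site d) (μ ν : Fin d) :
    bondL1At A z μ ν ≤ 4 * α₀ := by
  unfold bondL1At; linarith [hAα z μ, hAα (z + e μ) ν, hAα (z + e ν) μ, hAα z ν]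

/-- **ONE PLAQUETTE, ANY UNITARY BACKGROUND**: for unitary `W`, skew `A` with `‖A(b)‖ ≤ α₀`, `s ∈ [0,1]` and any direction `Y`,
`|hessPlaqAt (We^{sA}) A Y p′ − hessPlaqAt W A Y p′| ≤ (288δ + 48(1 + 6δ)α₀)·α₀·bl₁(Y)(p′)`, `δ = e^{α₀} − 1`. [folklore] -/
theorem abs_hessPlaqAt_vary_sub_le_W [Nonempty n] {W : Site d → Fin d → (Matrix n n ℂ)ˣ} (hW : IsUnitaryCfg W)
    {A : Site d → Fin d → Matrix n n ℂ} (hA : IsSkewDir A) {α₀ : ℝ} (hAα : ∀ y κ, ‖A y κ‖ ≤ α₀)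
    {s : ℝ} (hs0 : 0 ≤ s) (hs1 : s ≤ 1) (Y : Site d → Fin d → Matrix n n ℂ) (z : Site d) (μ ν : Fin d) :
    |hessPlaqAt (vary W A s) A Y z μ ν - hessPlaqAt W A Y z μ ν|
      ≤ (288 * (Real.exp α₀ - 1) + 48 * (1 + 6 * (Real.exp α₀ - 1)) * α₀) * α₀ * bondL1At Y z μ ν := by
  set V : Site d → Fin d → (Matrix n n ℂ)ˣ := vary W A s with hV
  set δ : ℝ := Real.exp α₀ - 1 with hδ
  have hVu : IsUnitaryCfg V := vary_isUnitaryCfg hW hA s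
  have hα0 : 0 ≤ α₀ := (norm_nonneg _).trans (hAα z μ)
  have hδ0 : 0 ≤ δ := by have := Real.add_one_le_exp α₀; rw [hδ]; linarith
  set bA : ℝ := bondL1At A z μ ν with hbA
  set bY : ℝ := bondL1At Y z μ ν with hbY
  have hbA0 : 0 ≤ bA := bondL1At_nonneg A z μ ν
  have hbY0 : 0 ≤ bY := bondL1At_nonneg Y z μ ν
  have hbA4 : bA ≤ 4 * α₀ := bondL1At_le_four_mul hAα z μ ν
  -- the segment's links stay within `δ` of `W`'s
  have hsδ : Real.exp (|s| * α₀) - 1 ≤ δ := by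
    rw [hδ, abs_of_nonneg hs0]
    have : s * α₀ ≤ 1 * α₀ := mul_le_mul_of_nonneg_right hs1 hα0
    rw [one_mul] at this
    linarith [Real.exp_le_exp.mpr this]
  have hlink : ∀ (x : Site d) (κ : Fin d), ‖((V x κ : (Matrix n n ℂ)ˣ) : Matrix n n ℂ) - (W x κ : Matrix n n ℂ)‖ ≤ δ := fun x κ =>
    (norm_vary_sub_le_of_sup hW hAα s x κ).trans hsδ
  -- the three Lipschitz letters
  have hdc : ‖dcurlAt V A Y z μ ν - dcurlAt W A Y z μ ν‖ ≤ 60 * δ * (bA * bY) :=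
    norm_dcurlAt_sub_dcurlAt_le hW hVu A Y z μ ν (hlink z μ) (hlink (z + e μ) ν) (hlink (z + e ν) μ)
  have hcY : ‖curlAt V Y z μ ν - curlAt W Y z μ ν‖ ≤ 6 * δ * bY :=
    (norm_curlAt_vary_sub_le hW hA hAα s Y z μ ν).trans
      (mul_le_mul_of_nonneg_right (mul_le_mul_of_nonneg_left hsδ (by norm_num : (0:ℝ) ≤ 6)) hbY0)
  have hcA : ‖curlAt V A z μ ν - curlAt W A z μ ν‖ ≤ 6 * δ * bA :=
    (norm_curlAt_vary_sub_le hW hA hAα s A z μ ν).trans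
      (mul_le_mul_of_nonneg_right (mul_le_mul_of_nonneg_left hsδ (by norm_num : (0:ℝ) ≤ 6)) hbA0)
  have hholδ : ‖((hol V z (plaqWord μ ν) : (Matrix n n ℂ)ˣ) : Matrix n n ℂ) - ((hol W z (plaqWord μ ν) : (Matrix n n ℂ)ˣ) : Matrix n n ℂ)‖
      ≤ (1 + 6 * δ) * bA := by
    have h := norm_hol_vary_sub_hol_le_curl hW hA hAα hs0 z μ ν
    have hsδ' : Real.exp (s * α₀) - 1 ≤ δ := by rw [← abs_of_nonneg hs0]; exact hsδ
    have hin : ‖curlAt W A z μ ν‖ + 6 * (Real.exp (s * α₀) - 1) * bondL1At A z μ ν ≤ bA + 6 * δ * bA := by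
      have h1 := norm_curlAt_le_bondL1At hW A z μ ν
      have h2 : 6 * (Real.exp (s * α₀) - 1) * bondL1At A z μ ν ≤ 6 * δ * bA :=
        mul_le_mul_of_nonneg_right (mul_le_mul_of_nonneg_left hsδ' (by norm_num)) hbA0
      rw [← hbA] at h1; linarith
    have h0 : 0 ≤ ‖curlAt W A z μ ν‖ + 6 * (Real.exp (s * α₀) - 1) * bondL1At A z μ ν := by
      have : 0 ≤ Real.exp (s * α₀) - 1 := by have := Real.add_one_le_exp (s * α₀); nlinarith
      positivity
    calc _ ≤ s * (‖curlAt W A z μ ν‖ + 6 * (Real.exp (s * α₀) - 1) * bondL1At A z μ ν) := h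
      _ ≤ 1 * (bA + 6 * δ * bA) := mul_le_mul hs1 hin h0 zero_le_one
      _ = (1 + 6 * δ) * bA := by ring
  -- the two operators `M(V) = dcurlAt V A Y + (d_VY)(d_VA)` and their difference
  set MV : Matrix n n ℂ := dcurlAt V A Y z μ ν + curlAt V Y z μ ν * curlAt V A z μ ν with hMV
  set MW : Matrix n n ℂ := dcurlAt W A Y z μ ν + curlAt W Y z μ ν * curlAt W A z μ ν with hMW
  have hMWn : ‖MW‖ ≤ 3 * (bA * bY) := by
    calc ‖MW‖ ≤ ‖dcurlAt W A Y z μ ν‖ + ‖curlAt W Y z μ ν * curlAt W A z μ ν‖ := norm_add_le _ _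
      _ ≤ 2 * (bA * bY) + bY * bA := by
          refine add_le_add (norm_dcurlAt_le hW A Y z μ ν) ?_
          exact (norm_mul_le _ _).trans (mul_le_mul (norm_curlAt_le_bondL1At hW Y z μ ν) (norm_curlAt_le_bondL1At hW A z μ ν)
            (norm_nonneg _) hbY0)
      _ = 3 * (bA * bY) := by ring
  have hMdiff : ‖MV - MW‖ ≤ 72 * δ * (bA * bY) := by
    have hsplit : MV - MW = (dcurlAt V A Y z μ ν - dcurlAt W A Y z μ ν)
        + ((curlAt V Y z μ ν - curlAt W Y z μ ν) * curlAt V A z μ ν + curlAt W Y z μ ν * (curlAt V A z μ ν - curlAt W A z μ ν)) := by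
      simp only [hMV, hMW]; noncomm_ring
    rw [hsplit]
    calc _ ≤ ‖dcurlAt V A Y z μ ν - dcurlAt W A Y z μ ν‖
          + ‖(curlAt V Y z μ ν - curlAt W Y z μ ν) * curlAt V A z μ ν + curlAt W Y z μ ν * (curlAt V A z μ ν - curlAt W A z μ ν)‖ :=
            norm_add_le _ _
      _ ≤ 60 * δ * (bA * bY) + (6 * δ * bY * bA + bY * (6 * δ * bA)) := by
          refine add_le_add hdc ((norm_add_le _ _).trans (add_le_add ?_ ?_))
          · exact (norm_mul_le _ _).trans (mul_le_mul hcY (norm_curlAt_le_bondL1At hVu A z μ ν) (norm_nonneg _) (by positivity))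
          · exact (norm_mul_le _ _).trans (mul_le_mul (norm_curlAt_le_bondL1At hW Y z μ ν) hcA (norm_nonneg _) hbY0)
      _ = 72 * δ * (bA * bY) := by ring
  -- the plaquette variables are unitary
  set HV : Matrix n n ℂ := ((hol V z (plaqWord μ ν) : (Matrix n n ℂ)ˣ) : Matrix n n ℂ) with hHVdef
  set HW : Matrix n n ℂ := ((hol W z (plaqWord μ ν) : (Matrix n n ℂ)ˣ) : Matrix n n ℂ) with hHWdef
  have hHV : HV ∈ unitary (Matrix n n ℂ) := mem_unitaryUnits.mp (hol_mem_of hVu _ _)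
  -- the difference of the densities
  have hid : hessPlaqAt V A Y z μ ν - hessPlaqAt W A Y z μ ν = -nReTr ((MV - MW) * HV + MW * (HV - HW)) := by
    have e : (MV - MW) * HV + MW * (HV - HW) = MV * HV - MW * HW := by noncomm_ring
    rw [e, T4TiltOscillation.nReTr_sub]
    simp only [hessPlaqAt, hMV, hMW, hHVdef, hHWdef]
    ring
  rw [hid, abs_neg]
  calc |nReTr ((MV - MW) * HV + MW * (HV - HW))|
      ≤ ‖(MV - MW) * HV + MW * (HV - HW)‖ := abs_nReTr_le_opNorm _
    _ ≤ ‖MV - MW‖ + ‖MW‖ * ((1 + 6 * δ) * bA) := by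
        refine (norm_add_le _ _).trans (add_le_add ?_ ?_)
        · exact le_of_eq (CStarRing.norm_mul_mem_unitary _ hHV)
        · exact (norm_mul_le _ _).trans (mul_le_mul_of_nonneg_left hholδ (norm_nonneg _))
    _ ≤ 72 * δ * (bA * bY) + 3 * (bA * bY) * ((1 + 6 * δ) * bA) := by
        have h1 : 0 ≤ (1 + 6 * δ) * bA := by positivity
        exact add_le_add hMdiff (mul_le_mul_of_nonneg_right hMWn h1)
    _ = (72 * δ + 3 * (1 + 6 * δ) * bA) * bA * bY := by ring
    _ ≤ (72 * δ + 3 * (1 + 6 * δ) * (4 * α₀)) * (4 * α₀) * bY := by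
        have h16 : 0 ≤ 3 * (1 + 6 * δ) := by positivity
        have h2 : 72 * δ + 3 * (1 + 6 * δ) * bA ≤ 72 * δ + 3 * (1 + 6 * δ) * (4 * α₀) :=
          add_le_add_right (mul_le_mul_of_nonneg_left hbA4 h16) _
        have h3 : 0 ≤ 72 * δ + 3 * (1 + 6 * δ) * (4 * α₀) := by positivity
        calc (72 * δ + 3 * (1 + 6 * δ) * bA) * bA * bY ≤ (72 * δ + 3 * (1 + 6 * δ) * (4 * α₀)) * bA * bY :=
              mul_le_mul_of_nonneg_right (mul_le_mul_of_nonneg_right h2 hbA0) hbY0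
          _ ≤ (72 * δ + 3 * (1 + 6 * δ) * (4 * α₀)) * (4 * α₀) * bY :=
              mul_le_mul_of_nonneg_right (mul_le_mul_of_nonneg_left hbA4 h3) hbY0
    _ = (288 * δ + 48 * (1 + 6 * δ) * α₀) * α₀ * bY := by ring

/-! ## §2 The window sum over one period -/

/-- **THE MIXED HESSIAN IS LIPSCHITZ IN ITS BASE ALONG THE SEGMENT, over one period**: for `P`-periodic `Y` (`P ≥ 1`) and `s ∈ [0,1]`,
`|hess (We^{sA}) A Y (perWin d P) − hess W A Y (perWin d P)| ≤ 2·#Plane·(288δ + 48(1+6δ)α₀)·α₀·dirL1 Y (periodBox P)`. [folklore] -/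
theorem abs_hess_vary_sub_hess_le_W [Nonempty n] {P : ℕ} (hP : 1 ≤ P) {W : Site d → Fin d → (Matrix n n ℂ)ˣ} (hW : IsUnitaryCfg W)
    {A : Site d → Fin d → Matrix n n ℂ} (hA : IsSkewDir A) {α₀ : ℝ} (hα0 : 0 ≤ α₀) (hAα : ∀ y κ, ‖A y κ‖ ≤ α₀)
    {Y : Site d → Fin d → Matrix n n ℂ} (hYP : IsPeriodicDir Y (P : ℤ)) {s : ℝ} (hs0 : 0 ≤ s) (hs1 : s ≤ 1) :
    |hess (vary W A s) A Y (perWin d P) - hess W A Y (perWin d P)|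
      ≤ 2 * (Fintype.card (T4AveragingDeficitWall.Plane d) : ℝ) * ((288 * (Real.exp α₀ - 1) + 48 * (1 + 6 * (Real.exp α₀ - 1)) * α₀) * α₀)
        * dirL1 Y (periodBox (d := d) P) := by
  set c : ℝ := (288 * (Real.exp α₀ - 1) + 48 * (1 + 6 * (Real.exp α₀ - 1)) * α₀) * α₀ with hc
  have hdiff : hess (vary W A s) A Y (perWin d P) - hess W A Y (perWin d P)
      = ∑ p ∈ perWin d P, (hessPlaqAt (vary W A s) A Y p.1 p.2.1.1 p.2.1.2 - hessPlaqAt W A Y p.1 p.2.1.1 p.2.1.2) := by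
    simp only [hess, hessPlaq, Finset.sum_sub_distrib]
  rw [hdiff]
  calc |∑ p ∈ perWin d P, (hessPlaqAt (vary W A s) A Y p.1 p.2.1.1 p.2.1.2 - hessPlaqAt W A Y p.1 p.2.1.1 p.2.1.2)|
      ≤ ∑ p ∈ perWin d P, |hessPlaqAt (vary W A s) A Y p.1 p.2.1.1 p.2.1.2 - hessPlaqAt W A Y p.1 p.2.1.1 p.2.1.2| := Finset.abs_sum_le_sum_abs _ _
    _ ≤ ∑ p ∈ perWin d P, c * bondL1At Y p.1 p.2.1.1 p.2.1.2 :=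
        Finset.sum_le_sum fun p _ => by rw [hc]; exact abs_hessPlaqAt_vary_sub_le_W hW hA hAα hs0 hs1 Y p.1 p.2.1.1 p.2.1.2
    _ = c * ∑ p ∈ perWin d P, bondL1At Y p.1 p.2.1.1 p.2.1.2 := by rw [Finset.mul_sum]
    _ ≤ c * (2 * (Fintype.card (T4AveragingDeficitWall.Plane d) : ℝ) * dirL1 Y (periodBox (d := d) P)) := by
        have hc0 : 0 ≤ c := by
          have hδ0 : 0 ≤ Real.exp α₀ - 1 := by have := Real.add_one_le_exp α₀; linarith
          rw [hc]; positivity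
        exact mul_le_mul_of_nonneg_left (sum_perWin_bondL1At_le hP hYP) hc0
    _ = 2 * (Fintype.card (T4AveragingDeficitWall.Plane d) : ℝ) * c * dirL1 Y (periodBox (d := d) P) := by ring

/-! ## §3 The (hEXP) letter of F55 at any unitary background, and its currency for `α₀ ≤ 1` -/

/-- **F55's EXPANSION LETTER AT AN ARBITRARY UNITARY BACKGROUND (weak form)**: for unitary `W`, skew `A` with `‖A(b)‖ ≤ α₀` and every `P`-periodic
direction `Y` (`P ≥ 1`),
`|dAction (We^{A}) Y (perWin d P) − dAction W Y (perWin d P) − hess W A Y (perWin d P)| ≤ ρ_W·dirL1 Y (periodBox P)`,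
`ρ_W = 2·#Plane·(288δ + 48(1 + 6δ)α₀)·α₀`, `δ = e^{α₀} − 1` — F45's mean-value reduction over §2. [folklore] -/
theorem abs_dAction_vary_sub_dAction_sub_hess_le_W [Nonempty n] {P : ℕ} (hP : 1 ≤ P) {W : Site d → Fin d → (Matrix n n ℂ)ˣ} (hW : IsUnitaryCfg W)
    {A : Site d → Fin d → Matrix n n ℂ} (hA : IsSkewDir A) {α₀ : ℝ} (hα0 : 0 ≤ α₀) (hAα : ∀ y κ, ‖A y κ‖ ≤ α₀)
    {Y : Site d → Fin d → Matrix n n ℂ} (hYP : IsPeriodicDir Y (P : ℤ)) :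
    |dAction (vary W A 1) Y (perWin d P) - dAction W Y (perWin d P) - hess W A Y (perWin d P)|
      ≤ 2 * (Fintype.card (T4AveragingDeficitWall.Plane d) : ℝ) * ((288 * (Real.exp α₀ - 1) + 48 * (1 + 6 * (Real.exp α₀ - 1)) * α₀) * α₀)
        * dirL1 Y (periodBox (d := d) P) :=
  abs_dAction_vary_sub_hess_le W A Y (perWin d P) fun _ hs => abs_hess_vary_sub_hess_le_W hP hW hA hα0 hAα hYP hs.1 hs.2

/-- **CURRENCY**: for `0 ≤ α₀ ≤ 1`, `δ = e^{α₀} − 1 ≤ 2α₀` and `ρ_W ≤ 2·#Plane·1200·α₀²` — `O(α₀²)`, i.e. `O(M⁻²)` in F55's regime `α₀ = α̂∕M` (the WEAK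
letter; the strong `O(M⁻³)` form is the successor's covariant summation by parts). [folklore] -/
theorem rhoW_le_of_le_one {α₀ : ℝ} (h0 : 0 ≤ α₀) (h1 : α₀ ≤ 1) (cP : ℝ) (hcP : 0 ≤ cP) :
    2 * cP * ((288 * (Real.exp α₀ - 1) + 48 * (1 + 6 * (Real.exp α₀ - 1)) * α₀) * α₀) ≤ 2 * cP * 1200 * α₀ ^ 2 := by
  have hδ : Real.exp α₀ - 1 ≤ 2 * α₀ := by
    have h := Real.abs_exp_sub_one_le (x := α₀) (by rwa [abs_of_nonneg h0])
    rw [abs_of_nonneg h0] at h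
    exact (le_abs_self _).trans h
  have hδ0 : 0 ≤ Real.exp α₀ - 1 := by have := Real.add_one_le_exp α₀; linarith
  have hin : (288 * (Real.exp α₀ - 1) + 48 * (1 + 6 * (Real.exp α₀ - 1)) * α₀) * α₀ ≤ 1200 * α₀ ^ 2 := by
    have h2 : 288 * (Real.exp α₀ - 1) ≤ 576 * α₀ := by linarith
    have h3 : 48 * (1 + 6 * (Real.exp α₀ - 1)) * α₀ ≤ 48 * 13 * α₀ := by
      have : 1 + 6 * (Real.exp α₀ - 1) ≤ 13 := by nlinarith
      nlinarith
    nlinarith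
  calc 2 * cP * ((288 * (Real.exp α₀ - 1) + 48 * (1 + 6 * (Real.exp α₀ - 1)) * α₀) * α₀) ≤ 2 * cP * (1200 * α₀ ^ 2) :=
        mul_le_mul_of_nonneg_left hin (by positivity)
    _ = 2 * cP * 1200 * α₀ ^ 2 := by ring

end

end Summit.QuantumFields.BalabanUV.T4Continuum.NE7ExpansionRemainderCurvedWeak
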